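import Summits.QuantumFields.YangMills.Theorems.UnitScaleTiltFluctuationComparisonRegPrGlobalSlackCanonicalPolymersVolume
import HarnessLib

/-!
# `UnitScaleTiltFluctuationComparisonRegPrGlobalSlackCanonicalPolymersCover` — THE SUMMABILITY ROW `LocCover` FOR THE CANONICAL POLYMERISATION OF A v3 FAMILY
# (crux `FluctuationComparisonRegPrL`, stmt-QuantumFields-19935, STUB 3⁗ `stub_globalTwoRunSlackFam`; width-lever lane A, the producer's second row)

Seat ym-ust-19935-slack g0 (prover).  `T3AlphaInputsAC.LocCover D κ C` — tree lengths are nonnegative and, for every fine site `y`,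
`Σ_{Y ∈ Loc K j h i ∋ y} e^{−κ𝓛(Y)} ≤ C` ([Balaban1985UV3] (45)–(46) p.267 «We use the remaining exp(−κ₁𝓛(X)) to control a sum over all X») — for the datum
`dataOfV3 p (canonPolymer p)`: OLD-term domains are disjoint blocks (at most one contains `y`), the dummy domain above the top is a singleton list, and the
NEW-term domains containing `y` are among the `tsys`-domains through the big block of `y`, whose exponential tree-length sum is LQB's kernel-checked
`TreeLengthTorus.hTree_torus` (`≤ K₀(32, 6)` for `κ ≥ κ₀(32, 6)`, [Balaban1987RG1] (0.26)/(0.30), Dimock's Lemma 25).  The one geometric input is that the point-set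
map `domSet` is INJECTIVE on domains (every big-block label below `N = max 1 (S_k/M₁)` is carried by a fine site), so that the canonical tree length of `domSet X` IS
`dj X`.

* §1 labels: `labelOf`, `mem_domSet_iff_label` (all labels of `y` below `N` ⇒ `y ∈ domSet X ↔ labelOf y ∈ X.1`), `not_mem_domSet_of_label_ge` (a label `≥ N` ⇒ `y` in
  no domain); §2 `exists_site_of_label` + `domSet_injective` (`k ≤ m + K`); §3 `canonTreeLen_domSet` (`= dj X`), `canonTreeLen_nonneg`;
* §4 **`locCover_canon (hκ0 : 0 ≤ κ) (hκ : kappa₀ 32 6 ≤ κ) : LocCover (dataOfV3 p (canonPolymer p)) κ (max 1 (K₀ 32 6))`** — the producer's SECOND row, discharged.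
Pure lattice combinatorics over LQB's tree-length bound; nothing of [Balaban1985UV3] is asserted.

References: T. Bałaban, CMP 102 (1985) 255–275 [Balaban1985UV3] ((24)–(25) p.262, (45)–(46) p.267, (59) p.270); CMP 109 (1987) 249–301 [Balaban1987RG1] ((0.26) p.257,
(0.30) p.258); J. Dimock, arXiv:1108.1335 [Dimock2013] (App. A Lemma 25).
-/

set_option autoImplicit false

noncomputable section

namespace Summit.QuantumFields.YangMills.Theorems.GlobalSlackCanonicalPolymers

open scoped BigOperators
open Finset
open Literature.MathematicalPhysics.QuantumFieldTheory.Balaban1983to89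
open Literature.MathematicalPhysics.QuantumFieldTheory.Balaban1983to89.T3ContinuumYM3Torus
open Literature.MathematicalPhysics.QuantumFieldTheory.Balaban1983to89.T3AlphaInputsAC
open Literature.MathematicalPhysics.QuantumFieldTheory.Balaban1983to89.T3AlphaInputsACTwoRunLevel
open Literature.MathematicalPhysics.QuantumFieldTheory.Balaban1983to89.TreeLengthTorus (tsys tcubeSys TPt hTree_torus)
open Literature.MathematicalPhysics.QuantumFieldTheory.Balaban1983to89.B12TreeDecay (kappa₀ K₀ K₀_pos)
open Literature.MathematicalPhysics.QuantumFieldTheory.Balaban1985CMP102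
open Literature.MathematicalPhysics.QuantumFieldTheory.Balaban1985CMP102.Setting
open Summit.QuantumFields.Balaban3D.Carriers
open Summit.QuantumFields.Balaban3D.Proofs.Primitives
open Summit.QuantumFields.YangMills.Theorems

variable {F : T3Family}

/-! ## §1 Big-block labels and membership in a `domSet` -/

/-- The big-block label of a fine site at scale `k`, as a cube of the `N`-torus of big blocks. [cite: Balaban1985UV3, (39) p.266] -/
def labelOf (M₁ K k : ℕ) {N : ℕ} [NeZero N] (x : Site (F.P K) 0) : TPt 3 N :=
  fun μ => ((bigBlockOf M₁ k x μ : ℕ) : ZMod N)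

/-- Membership in a `domSet` (definitional). [cite: Balaban1985UV3, (59) p.270] -/
theorem mem_domSet_iff (M₁ K k : ℕ) {N : ℕ} [NeZero N] (X : (tsys 3 N).Dom) (x : Site (F.P K) 0) :
    x ∈ domSet (F := F) M₁ K k X ↔ ∃ b ∈ X.1, bigBlockOf M₁ k x = fun μ => ((b : Fin 3 → ZMod N) μ).val :=
  Iff.rfl

/-- If all labels of `x` are below `N`, membership in `domSet X` is membership of `labelOf x` in `X.1`. [cite: Balaban1985UV3, (59) p.270] -/
theorem mem_domSet_iff_label (M₁ K k : ℕ) {N : ℕ} [NeZero N] (X : (tsys 3 N).Dom) (x : Site (F.P K) 0)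
    (hx : ∀ μ, bigBlockOf M₁ k x μ < N) : x ∈ domSet (F := F) M₁ K k X ↔ labelOf (F := F) M₁ K k x ∈ X.1 := by
  rw [mem_domSet_iff]
  constructor
  · rintro ⟨b, hb, heq⟩
    have : labelOf (F := F) M₁ K k (N := N) x = b := by
      funext μ
      simp only [labelOf]
      rw [congrFun heq μ, ZMod.natCast_zmod_val]
    rwa [this]
  · intro h
    refine ⟨labelOf (F := F) M₁ K k x, h, funext fun μ => ?_⟩
    simp only [labelOf]
    rw [ZMod.val_natCast, Nat.mod_eq_of_lt (hx μ)]

/-- A fine site with some label `≥ N` lies in NO `domSet` (labels of cubes are `< N`). [cite: Balaban1985UV3, (59) p.270] -/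
theorem not_mem_domSet_of_label_ge (M₁ K k : ℕ) {N : ℕ} [NeZero N] (X : (tsys 3 N).Dom) (x : Site (F.P K) 0)
    (hx : ¬ ∀ μ, bigBlockOf M₁ k x μ < N) : x ∉ domSet (F := F) M₁ K k X := by
  rintro ⟨b, -, heq⟩
  exact hx fun μ => by rw [congrFun heq μ]; exact ZMod.val_lt (b μ)

/-! ## §2 Every cube label is carried by a fine site; `domSet` is injective on domains -/

variable {𝔠 : AlphaConsts F.L (suGroupModel 2).N} {γ : ℝ} {hγ : 0 < γ} {hγ1 : γ ≤ (min 𝔠.gamma0 1) ^ 2}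

/-- **EVERY BIG-BLOCK LABEL BELOW `N = max 1 (S_k/M₁)` IS THE LABEL OF SOME FINE SITE** (`k ≤ m + K`): the corner `b·M₁` of the big block (no wrap-around since
`(b+1)M₁ ≤ S_k`), or the origin if `S_k < M₁` (`N = 1`), lifted to the fine torus by the surjective block map. [cite: Balaban1985UV3, (39) p.266] -/
theorem exists_site_of_label (K k : ℕ) (hk : k ≤ F.m + K) (b : TPt 3 (nblkOf (SK F 𝔠 γ hγ hγ1 K) 𝔠.lane.carrier k)) :
    ∃ x : Site (F.P K) 0, bigBlockOf 𝔠.lane.carrier.M₁ k x = fun μ => (b μ).val := by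
  have hM0 : 0 < 𝔠.M₁ := 𝔠.M₁_pos
  have hkP : k ≤ (F.P K).m + (F.P K).K := hk
  by_cases hcase : 𝔠.M₁ ≤ (F.P K).sitesPerDir k
  · have hN : nblkOf (SK F 𝔠 γ hγ hγ1 K) 𝔠.lane.carrier k = (F.P K).sitesPerDir k / 𝔠.M₁ := by
      rw [nblkOf_SK]; exact max_eq_right (Nat.div_pos hcase hM0)
    have ht : ∀ μ, (b μ).val * 𝔠.M₁ + 𝔠.M₁ ≤ (F.P K).sitesPerDir k := fun μ => by
      have h1 : (b μ).val < (F.P K).sitesPerDir k / 𝔠.M₁ := lt_of_lt_of_eq (ZMod.val_lt (b μ)) hN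
      calc (b μ).val * 𝔠.M₁ + 𝔠.M₁ = ((b μ).val + 1) * 𝔠.M₁ := by ring
        _ ≤ ((F.P K).sitesPerDir k / 𝔠.M₁) * 𝔠.M₁ := Nat.mul_le_mul_right _ h1
        _ ≤ (F.P K).sitesPerDir k := Nat.div_mul_le_self _ _
    let z : Site (F.P K) k := offSite F K k 𝔠.M₁ (fun μ => (b μ).val) (w := 𝔠.M₁) fun _ => ⟨0, hM0⟩
    obtain ⟨x, hx⟩ := coarsen_surjective k hkP z
    refine ⟨x, funext fun μ => ?_⟩
    show ((coarsen k x) μ).val / 𝔠.M₁ = (b μ).val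
    rw [hx]
    exact bigLabel_offSite K k 𝔠.M₁ hM0 _ _ μ (ht μ)
  · rw [not_le] at hcase
    have hN : nblkOf (SK F 𝔠 γ hγ hγ1 K) 𝔠.lane.carrier k = 1 := by
      rw [nblkOf_SK, Nat.div_eq_of_lt hcase]; rfl
    have hS : 0 < (F.P K).sitesPerDir k := Nat.pos_of_ne_zero ((F.P K).sitesPerDir_ne_zero k)
    let z : Site (F.P K) k := offSite F K k 𝔠.M₁ (fun _ => 0) (w := (F.P K).sitesPerDir k) fun _ => ⟨0, hS⟩
    obtain ⟨x, hx⟩ := coarsen_surjective k hkP z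
    refine ⟨x, funext fun μ => ?_⟩
    have hb : (b μ).val = 0 := by have := lt_of_lt_of_eq (ZMod.val_lt (b μ)) hN; omega
    show ((coarsen k x) μ).val / 𝔠.M₁ = (b μ).val
    rw [hx, hb]
    exact bigLabel_offSite_zero K k 𝔠.M₁ hcase.le _ μ

/-- **THE POINT-SET MAP `domSet` IS INJECTIVE ON DOMAINS** (`k ≤ m + K`): the point set determines the set of cubes, every cube being inhabited. [cite: Balaban1985UV3, (59) p.270] -/
theorem domSet_injective (K k : ℕ) (hk : k ≤ F.m + K) :
    Function.Injective (domSet (F := F) 𝔠.lane.carrier.M₁ K k :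
      (tsys 3 (nblkOf (SK F 𝔠 γ hγ hγ1 K) 𝔠.lane.carrier k)).Dom → Set (Site (F.P K) 0)) := by
  have key : ∀ X X' : (tsys 3 (nblkOf (SK F 𝔠 γ hγ hγ1 K) 𝔠.lane.carrier k)).Dom,
      domSet (F := F) 𝔠.lane.carrier.M₁ K k X = domSet (F := F) 𝔠.lane.carrier.M₁ K k X' → X.1 ⊆ X'.1 := by
    intro X X' h b hb
    obtain ⟨x, hx⟩ := exists_site_of_label (𝔠 := 𝔠) (γ := γ) (hγ := hγ) (hγ1 := hγ1) K k hk b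
    have hmem : x ∈ domSet (F := F) 𝔠.lane.carrier.M₁ K k X := ⟨b, hb, hx⟩
    rw [h] at hmem
    obtain ⟨b', hb', hx'⟩ := hmem
    have hbb : b = b' := by
      funext μ
      apply ZMod.val_injective
      have := congrFun (hx.symm.trans hx') μ
      exact this
    rwa [hbb]
  intro X X' h
  exact Subtype.ext (Finset.Subset.antisymm (key X X' h) (key X' X h.symm))

/-! ## §3 The canonical tree length of a domain's point set is its tree length -/

/-- **`canonTreeLen (domSet X) = dj X`** at term level `k+1` (`k ≤ m + K`): by injectivity the domains with the point set of `X` are `X` alone. [cite: Balaban1985UV3, (24)–(25) p.262] -/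
theorem canonTreeLen_domSet (p : ∀ K, AlphaInputsT3AC.PkgAtV3 F 𝔠 γ hγ hγ1 K) (K k : ℕ) (hk : k ≤ F.m + K)
    (X : (tsys 3 (nblkOf (SK F 𝔠 γ hγ hγ1 K) 𝔠.lane.carrier k)).Dom) :
    canonTreeLen p K (k + 1) (domSet (F := F) 𝔠.lane.carrier.M₁ K k X) = (tsys 3 (nblkOf (SK F 𝔠 γ hγ hγ1 K) 𝔠.lane.carrier k)).dj X := by
  unfold canonTreeLen
  have hset : {X' : (tsys 3 (nblkOf (SK F 𝔠 γ hγ hγ1 K) 𝔠.lane.carrier k)).Dom |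
      domSet (F := F) 𝔠.lane.carrier.M₁ K k X' = domSet (F := F) 𝔠.lane.carrier.M₁ K k X} = {X} := by
    ext X'
    simp only [Set.mem_setOf_eq, Set.mem_singleton_iff]
    exact ⟨fun h => domSet_injective K k hk h, fun h => by rw [h]⟩
  show sInf ((fun X' => (tsys 3 (nblkOf (SK F 𝔠 γ hγ hγ1 K) 𝔠.lane.carrier k)).dj X') ''
    {X' : (tsys 3 (nblkOf (SK F 𝔠 γ hγ hγ1 K) 𝔠.lane.carrier k)).Dom | domSet (F := F) 𝔠.lane.carrier.M₁ K k X' = domSet (F := F) 𝔠.lane.carrier.M₁ K k X}) = _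
  rw [hset, Set.image_singleton, csInf_singleton]

/-- The canonical tree length is nonnegative (an infimum of tree lengths, or `0`). [cite: Balaban1985UV3, (24)–(25) p.262] -/
theorem canonTreeLen_nonneg (p : ∀ K, AlphaInputsT3AC.PkgAtV3 F 𝔠 γ hγ hγ1 K) (K i : ℕ) (Y : Set (Site (F.P K) 0)) :
    0 ≤ canonTreeLen p K i Y := by
  unfold canonTreeLen
  refine Real.sInf_nonneg fun t ht => ?_
  obtain ⟨X, -, rfl⟩ := ht
  exact (tsys 3 _).dj_nonneg X

/-! ## §4 The summability row for the canonical polymerisation -/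

/-- One summand is at most the indicator: `1_Y(y)·e^{−κ𝓛} ≤ 1_Y(y)` for `κ ≥ 0`, `𝓛 ≥ 0`. [folklore] -/
theorem indicator_exp_le_indicator {α : Type*} (Y : Set α) (y : α) {κ t : ℝ} (hκ : 0 ≤ κ) (ht : 0 ≤ t) :
    Y.indicator (fun _ => Real.exp (-κ * t)) y ≤ Y.indicator (fun _ => (1 : ℝ)) y :=
  Set.indicator_le_indicator (by rw [Real.exp_le_one_iff]; nlinarith)

/-- **`LocCover` FOR THE CANONICAL POLYMERISATION OF EVERY v3 FAMILY**: for `0 ≤ κ` with `κ₀(32, 6) ≤ κ` (LQB's torus tree-decay threshold, d = 3), tree lengths are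
nonnegative and `Σ_{Y ∈ Loc ∋ y} e^{−κ𝓛(Y)} ≤ max 1 K₀(32, 6)` for every fine site `y` — old blocks are disjoint (≤ 1), the dummy domain is one (≤ 1), the retained new
domains through the big block of `y` are bounded by `hTree_torus`.  The producer's SECOND row, discharged. [cite: Balaban1985UV3, (45)-(46) p.267; Balaban1987RG1, (0.26) p.257, (0.30) p.258] -/
theorem locCover_canon (p : ∀ K, AlphaInputsT3AC.PkgAtV3 F 𝔠 γ hγ hγ1 K) {κ : ℝ} (hκ0 : 0 ≤ κ) (hκ : kappa₀ (4 * 2 ^ 3) (2 * 3) ≤ κ) :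
    LocCover (AlphaInputsT3AC.dataOfV3 p (canonPolymer p)) κ (max 1 (K₀ (4 * 2 ^ 3) (2 * 3))) := by
  classical
  refine ⟨fun K i Y => canonTreeLen_nonneg p K i Y, fun K j h i y => ?_⟩
  change ∑ Y ∈ canonLoc p K j h i, Y.indicator (fun _ => Real.exp (-κ * canonTreeLen p K i Y)) y ≤ _
  have hK₀ : (1 : ℝ) ≤ max 1 (K₀ (4 * 2 ^ 3) (2 * 3)) := le_max_left _ _
  -- generic bound: each summand ≤ the indicator
  have hterm : ∀ Y : Set (Site (F.P K) 0), Y.indicator (fun _ => Real.exp (-κ * canonTreeLen p K i Y)) y ≤ Y.indicator (fun _ => (1 : ℝ)) y :=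
    fun Y => indicator_exp_le_indicator Y y hκ0 (canonTreeLen_nonneg p K i Y)
  have hterm0 : ∀ Y : Set (Site (F.P K) 0), 0 ≤ Y.indicator (fun _ => Real.exp (-κ * canonTreeLen p K i Y)) y :=
    fun Y => Set.indicator_nonneg (fun _ _ => (Real.exp_pos _).le) y
  cases j with
  | zero =>
    simp only [canonLoc, Finset.sum_empty]
    exact le_trans zero_le_one hK₀
  | succ k =>
    by_cases hk : k + 1 ≤ K
    · by_cases hik : i = k + 1
      · -- NEW terms: the retained domains through the big block of `y`
        subst hik
        have hkm : k ≤ F.m + K := by have := F.hm; omega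
        simp only [canonLoc, if_pos hk, ite_true]
        rw [Finset.sum_image (fun X _ X' _ h => domSet_injective K k hkm h)]
        simp only [canonTreeLen_domSet p K k hkm]
        by_cases hlab : ∀ μ, bigBlockOf 𝔠.lane.carrier.M₁ k y μ < nblkOf (SK F 𝔠 γ hγ hγ1 K) 𝔠.lane.carrier k
        · have hind : ∀ X ∈ newDoms p K k h,
              (domSet (F := F) 𝔠.lane.carrier.M₁ K k X).indicator (fun _ => Real.exp (-κ * (tsys 3 _).dj X)) y =
                if labelOf (F := F) 𝔠.lane.carrier.M₁ K k y ∈ X.1 then Real.exp (-κ * (tsys 3 _).dj X) else 0 := by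
            intro X _
            rw [Set.indicator_apply]
            simp only [mem_domSet_iff_label _ K k X y hlab]
          rw [Finset.sum_congr rfl hind, ← Finset.sum_filter]
          refine le_trans ?_ (le_max_right _ _)
          refine le_trans (Finset.sum_le_sum_of_subset_of_nonneg ?_ fun X _ _ => (Real.exp_pos _).le)
            (hTree_torus 3 (nblkOf (SK F 𝔠 γ hγ hγ1 K) 𝔠.lane.carrier k) hκ (labelOf (F := F) 𝔠.lane.carrier.M₁ K k y))
          intro X hX
          rw [Finset.mem_filter] at hX
          simp only [B12TreeDecay.CubeSystem.toCubeCover_above, B12TreeDecay.CubeSystem.mem_above, TreeLengthTorus.tcubeSys_cubes]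
          exact hX.2
        · have hzero : ∀ X ∈ newDoms p K k h,
              (domSet (F := F) 𝔠.lane.carrier.M₁ K k X).indicator (fun _ => Real.exp (-κ * (tsys 3 _).dj X)) y = 0 :=
            fun X _ => Set.indicator_of_notMem (not_mem_domSet_of_label_ge _ K k X y hlab) _
          rw [Finset.sum_congr rfl hzero, Finset.sum_const_zero]
          exact le_trans zero_le_one hK₀
      · by_cases hi : i ∈ Finset.Icc 1 k
        · -- OLD terms: disjoint blocks, at most one contains `y`
          simp only [canonLoc, if_pos hk, if_neg hik, if_pos hi]
          refine le_trans ?_ hK₀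
          set S := (oldBlocks 𝔠.lane.carrier.M₁ (rcolOf (SK F 𝔠 γ hγ hγ1 K) 𝔠.lane.carrier) h i).image (blockSet K i) with hS
          set B₀ : Set (Site (F.P K) 0) := blockSet K i (coarsen i y) with hB₀
          have hle : ∀ Y ∈ S, Y.indicator (fun _ => Real.exp (-κ * canonTreeLen p K i Y)) y ≤ if Y = B₀ then (1 : ℝ) else 0 := by
            intro Y hY
            refine (hterm Y).trans ?_
            by_cases hyY : y ∈ Y
            · obtain ⟨y', -, rfl⟩ := Finset.mem_image.mp hY
              have : blockSet K i y' = B₀ := by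
                have hc : coarsen i y = y' := hyY
                rw [hB₀, hc]
              rw [Set.indicator_of_mem hyY, if_pos this]
            · rw [Set.indicator_of_notMem hyY]
              split_ifs <;> norm_num
          refine (Finset.sum_le_sum hle).trans ?_
          rw [Finset.sum_ite_eq']
          split_ifs <;> norm_num
        · simp only [canonLoc, if_pos hk, if_neg hik, if_neg hi, Finset.sum_empty]
          exact le_trans zero_le_one hK₀
    · by_cases hi1 : i = 1
      · subst hi1
        simp only [canonLoc, if_neg hk, ite_true, Finset.sum_singleton]
        exact le_trans ((hterm _).trans (by rw [Set.indicator_of_mem (Set.mem_univ y)])) hK₀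
      · simp only [canonLoc, if_neg hk, if_neg hi1, Finset.sum_empty]
        exact le_trans zero_le_one hK₀

end Summit.QuantumFields.YangMills.Theorems.GlobalSlackCanonicalPolymers

end
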